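import Literature.MeasureTheory.Group.InvariantQuotientUnfoldingBochner    -- ★ `fiberIntegralE`, `fiberIntegralE_mul_comp_mk`, `integral_fiberIntegralE_eq_mul_integral` (Weil, Bochner form)
import Literature.MeasureTheory.Group.InvariantQuotientConjugacySum        -- ★ `descConj`, `descConj_mk`
import HarnessLib

/-!
# Harish-Chandra's descent of orbital integrals, the three elementary steps: right translation of the cut-off, torus invariance of its fibre integral, and Weil's
# formula on `G ⊇ T` for the weighted orbital integrand (Harish-Chandra (van Dijk) LNM 162, Part I §3 Lemmas 22–23; Folland, Thm. 2.49)

Topic `MeasureTheory/Group`; namespace `Literature.MeasureTheory.Group`.  THEOREMS ONLY (no definition, no named fact, no instance, no notation, no `sorry`).  Cell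
`pub/hodgecm-mathlib` (D-0151), crux H413 = stmt-HodgeConjecture-24833, floor-2 line «N6nsGerm», binder `hD` of ★ `exists_nhds_stableOrbitalIntegralRel_eq_of_central_singular_inv`
(p841647) — brick **B4-meas FILE M2b-α** (the steps of the identity `Φ^G(t, ψ) = Φ^M(t, ψ_M)`; LEAD F0P3a-plan (g9) T8-88 register); seat F0P3a-p08 (g13).  HONEST LABEL: HC_CM is
proved only modulo the printed citations until rung 0 closes; generic measure theory, no letter.

THE MATHEMATICS.  `ψ_M(m) = ∫_G β(x) • ψ(x m x⁻¹) dν` (★ `OrbitalDescentFunction`), `ν` right invariant.  (α1) RIGHT TRANSLATION: `ψ_M(k t k⁻¹) = ∫_G β(x k⁻¹) • ψ(x t x⁻¹) dν(x)`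
(`x ↦ x k`).  (α2) TORUS INVARIANCE: for a subgroup `T` with a right-invariant measure `ν_T`, `A(y, k) := ∫_T β(y s k⁻¹) dν_T(s)` satisfies `A(y, k s₀) = A(y, k)` (`s₀ ∈ T`), so `A(y, ·)`
descends to `M ⧸ T`.  (α3) WEIL ON `G ⊇ T`: for `T` centralising `t` and a `G`-invariant Radon measure `μ` on `G ⧸ T` with unfolding constant `c = c(μ; ν_T, ν)`,
`c · ∫_G β(x k⁻¹) ψ(x t x⁻¹) dν(x) = ∫_{G⧸T} A(ẏ, k) · ψ(y t y⁻¹) dμ(ẏ)` — ★ `integral_fiberIntegralE_eq_mul_integral` applied to `x ↦ β(x k⁻¹)·ψ̃(π x)`, the factor `ψ̃ = descConj t T ψ`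
being constant on cosets (★ `fiberIntegralE_mul_comp_mk`).  For the CANONICAL `μ = ν∕ν_T` the constant is `1` (★ `unfoldingConstant_quotientMeasure`).  The remaining step of the
identity (M2b-β: Fubini on `G⧸T × M⧸T` and `∫_{M⧸T} A(y, ·) = ∫_M β(y k) dν_M = 1` on `C·M`) is the next file.

* **`integral_smul_conj_conj_eq_integral_mul_right`** (α1), **`integral_comp_mul_coe_mul_inv_eq`** (α2), **`mul_integral_mul_descConj_eq_integral_fiberIntegralE_mul`** (α3).

## References
* [HarishChandra1970] Harish-Chandra (notes by G. van Dijk), *Harmonic Analysis on Reductive p-adic Groups*, LNM 162 (1970), Part I §3 Lemmas 22–23.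
* [Folland1995] G. B. Folland, *A Course in Abstract Harmonic Analysis* (1995), §2.6 Thm. 2.49 (Weil's formula).
-/

set_option autoImplicit false

noncomputable section

open MeasureTheory MeasureTheory.Measure Topology Set Filter Function
open scoped Pointwise NNReal

namespace Literature.MeasureTheory.Group

-- the quotient carries the Borel σ-algebra supplied by the user (idiom of ★ `InvariantQuotientUnfolding(Bochner)`)

section Steps

variable {G : Type*} [Group G] [MeasurableSpace G] {E : Type*} [NormedAddCommGroup E] [NormedSpace ℝ E]

/-- **(α1) Right translation of the cut-off**: `∫_G β(x) • ψ(x (k t k⁻¹) x⁻¹) dν = ∫_G β(x k⁻¹) • ψ(x t x⁻¹) dν` for a right-invariant `ν` (substitute `x ↦ x k`).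
[cite: HarishChandra1970, Part I §3 Lemma 22] -/
theorem integral_smul_conj_conj_eq_integral_mul_right [MeasurableMul G] (ν : Measure G) [ν.IsMulRightInvariant] (β : G → ℝ) (ψ : G → E) (t k : G) :
    ∫ x, β x • ψ (x * (k * t * k⁻¹) * x⁻¹) ∂ν = ∫ x, β (x * k⁻¹) • ψ (x * t * x⁻¹) ∂ν := by
  have h := integral_mul_right_eq_self (μ := ν) (fun y => β (y * k⁻¹) • ψ (y * t * y⁻¹)) k
  simp only [mul_inv_cancel_right, mul_inv_rev] at h
  rw [← h]
  congr 1 with x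
  simp only [mul_assoc]

/-- **(α2) Torus invariance of the fibre integral of the translated cut-off**: `∫_T β(y s (k s₀)⁻¹) dν_T(s) = ∫_T β(y s k⁻¹) dν_T(s)` for `s₀ ∈ T` and a right-invariant `ν_T`
(substitute `s ↦ s s₀`); hence `k ↦ ∫_T β(y s k⁻¹) dν_T(s)` is constant on the cosets `k T`. [cite: HarishChandra1970, Part I §3 Lemma 22] -/
theorem integral_comp_mul_coe_mul_inv_eq (T : Subgroup G) [MeasurableMul T] (νT : Measure T) [νT.IsMulRightInvariant] (β : G → ℝ) (y k : G) (s₀ : T) :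
    ∫ s : T, β (y * (s : G) * (k * (s₀ : G))⁻¹) ∂νT = ∫ s : T, β (y * (s : G) * k⁻¹) ∂νT := by
  have h := integral_mul_right_eq_self (μ := νT) (fun s : T => β (y * (s : G) * (s₀ : G)⁻¹ * k⁻¹)) s₀
  simp only [Subgroup.coe_mul, mul_assoc, mul_inv_cancel_left] at h
  simp only [mul_inv_rev, mul_assoc]
  exact h.symm

end Steps

section Weil

variable {G : Type*} [Group G] [TopologicalSpace G] [IsTopologicalGroup G] [LocallyCompactSpace G] [SecondCountableTopology G] [T2Space G]
  [MeasurableSpace G] [BorelSpace G]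
  (T : Subgroup G) [hT : IsClosed (T : Set G)] (νT : Measure T) [νT.IsMulLeftInvariant] [SFinite νT] [IsFiniteMeasureOnCompacts νT]
  [MeasurableSpace (G ⧸ T)] [BorelSpace (G ⧸ T)]
  (μ : Measure (G ⧸ T)) [SMulInvariantMeasure G (G ⧸ T) μ] [IsFiniteMeasureOnCompacts μ]
  (ν : Measure G) [ν.IsHaarMeasure]

/-- **(α3) Weil's formula on `G ⊇ T` for the weighted orbital integrand.**  `T` a closed subgroup centralising `t`, `μ` a `G`-invariant Radon measure on `G ⧸ T` with unfolding
constant `c = c(μ; ν_T, ν)` (`= 1` for the canonical `μ = ν∕ν_T`, ★ `unfoldingConstant_quotientMeasure`), `β ∈ C_c(G)` real, `ψ` continuous complex: 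
`c · ∫_G β(x k⁻¹) ψ(x t x⁻¹) dν(x) = ∫_{G⧸T} (∫_T β(y s k⁻¹) dν_T(s)) · ψ(y t y⁻¹) dμ(ẏ)` — the inner factor is ★ `fiberIntegralE` of the translated cut-off, the outer factor ★ `descConj t T ψ`.
[cite: Folland1995, §2.6 Thm. 2.49] [cite: HarishChandra1970, Part I §3 Lemma 23] -/
theorem mul_integral_mul_descConj_eq_integral_fiberIntegralE_mul (t : G) (htT : ∀ s ∈ T, s * t = t * s)
    {β : G → ℝ} (hβc : Continuous β) (hβs : HasCompactSupport β) {ψ : G → ℂ} (hψc : Continuous ψ) (k : G) :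
    (unfoldingConstant T νT μ ν : ℂ) * ∫ x, (β (x * k⁻¹) : ℂ) * ψ (x * t * x⁻¹) ∂ν =
      ∫ y, fiberIntegralE T νT (fun x => (β (x * k⁻¹) : ℂ)) y * descConj t T htT ψ y ∂μ := by
  -- the integrand `x ↦ β(x k⁻¹) · ψ̃(π x)` is continuous with compact support, hence `ν`-integrable and Borel
  have hcont : Continuous fun x => (β (x * k⁻¹) : ℂ) * ψ (x * t * x⁻¹) :=
    (Complex.continuous_ofReal.comp (hβc.comp (continuous_id.mul continuous_const))).mul
      (hψc.comp ((continuous_id.mul continuous_const).mul continuous_id.inv))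
  have hsupp : HasCompactSupport fun x => (β (x * k⁻¹) : ℂ) * ψ (x * t * x⁻¹) := by
    refine HasCompactSupport.mul_right ?_
    have h1 : HasCompactSupport fun x => β (x * k⁻¹) := by
      have e : (fun x => β (x * k⁻¹)) = β ∘ Homeomorph.mulRight k⁻¹ := rfl
      rw [e]
      exact hβs.comp_homeomorph _
    exact h1.comp_left Complex.ofReal_zero
  have hint : Integrable (fun x => (β (x * k⁻¹) : ℂ) * ψ (x * t * x⁻¹)) ν := hcont.integrable_of_hasCompactSupport hsupp
  have key := integral_fiberIntegralE_eq_mul_integral T νT μ ν hcont.measurable hint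
  rw [← key]
  refine integral_congr_ae (Eventually.of_forall fun y => ?_)
  -- `β(x k⁻¹) ψ(x t x⁻¹) = β(x k⁻¹) · ψ̃(π x)` and the second factor comes out of the fibre integral
  have hfun : (fun x => (β (x * k⁻¹) : ℂ) * ψ (x * t * x⁻¹)) = fun x => (β (x * k⁻¹) : ℂ) * descConj t T htT ψ (QuotientGroup.mk x) := by
    funext x; rw [descConj_mk]
  rw [hfun, fiberIntegralE_mul_comp_mk]

end Weil

end Literature.MeasureTheory.Group

end
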